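import Mathlib
import Summits.Ventures.PercRepro.TriangleCapNearStar

/-!
# PercRepro — THE VERTEX DECOMPOSITION OF `Σ d²` AT ANY VERTEX, AND THE EQUALITY CASE OF THE VERTEX BOUND
(p3, gen 50; part 215)

For ANY graph `H` with `s` edges and ANY vertex `w`, with `F` the `s − d(w)` edges not containing `w`
(`offEdges`), `c(v) = #{e ∈ F : v ∈ e}` (`offDeg`), `att = Σ_{v ∈ N(w)} c(v)` (`attach`: the incidences of the
off-edges with the neighbours of `w`) and `offAdjPairs` the ordered pairs of distinct off-edges sharing a vertex:

  **`Σ_v d(v)² = d(w)² + d(w) + 2 |F| + 2 att + offAdjPairs`**   (`sum_deg_sq_vertex_decomposition`).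

Every vertex `v ≠ w` has degree `[w ~ v] + c(v)` (`deg_eq_boole_add_offDeg`: its incidence set is `{s(v, w)}` if
`w ~ v` together with the off-edges through `v`); squaring, `Σ_{v ≠ w} d(v)² = d(w) + 2 att + Σ c(v) + Σ c(v)(c(v) − 1)`,
with `Σ_{v ≠ w} c(v) = 2 |F|` (every off-edge has two ends, both `≠ w`) and `Σ_{v ≠ w} c(v)(c(v) − 1) = offAdjPairs`
(the pairs sharing a vertex are the disjoint union over `v ≠ w` of the ordered pairs of distinct off-edges at `v`).

In a triangle-free graph `att ≤ |F|` (`attach_le`: an off-edge meets `N(w)` at most once — `att` double-counted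
as `Σ_{e ∈ F} |N(w) ∩ e|`) and `offAdjPairs ≤ |F| (|F| − 1)`, so with `t = |F| = s − d(w)`:
`Σ d² + 2 t (d(w) − 1) ≤ s (s + 1)` — §10ch's vertex bound (`sum_deg_sq_le_of_vertex`), now WITH ITS EQUALITY
CASE (`vertex_bound_eq_iff`, `w` not isolated): equality iff every off-edge meets `N(w)` and every two off-edges share a vertex.  At
`t = 2` this is the near-star formula of part 212 (`|N(w) ∩ e| = |N(w) ∩ f| = |e ∩ f| = 1`).

Axioms: standard.
-/

namespace PercRepro

namespace TriangleCap

namespace C047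

open Finset

variable {V : Type*} [Fintype V] [DecidableEq V]

/-- The number of edges not containing `w` that contain `v`. -/
def offDeg (H : SimpleGraph V) [DecidableRel H.Adj] (w v : V) : ℕ :=
  ((offEdges H w).filter (fun e => v ∈ e)).card

/-- The incidences between the neighbours of `w` and the edges not containing `w`: `Σ_{v ∈ N(w)} offDeg w v`. -/
def attach (H : SimpleGraph V) [DecidableRel H.Adj] (w : V) : ℕ :=
  ∑ v ∈ univ.filter (fun v => H.Adj w v), offDeg H w v

/-- The ordered pairs of distinct edges not containing `w` that share a vertex. -/
def offAdjPairs (H : SimpleGraph V) [DecidableRel H.Adj] (w : V) : ℕ :=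
  ((offEdges H w).offDiag.filter (fun p : Sym2 V × Sym2 V => ∃ v, v ∈ p.1 ∧ v ∈ p.2)).card

/-- `|F| + d(w) = s` (the tree's `offEdges D v = D.edgeFinset.filter (v ∉ ·)`, part 140). -/
theorem card_offEdges_add_deg (H : SimpleGraph V) [DecidableRel H.Adj] (w : V) :
    (offEdges H w).card + deg H w = H.edgeFinset.card := by
  have := card_filter_add_card_filter_not (s := H.edgeFinset) (p := fun e => w ∈ e)
  rw [deg_eq_card_filter_mem]
  unfold offEdges
  omega

/-- An off-edge does not contain `w`. -/
theorem notMem_of_mem_offEdges (H : SimpleGraph V) [DecidableRel H.Adj] (w : V) {e : Sym2 V}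
    (he : e ∈ offEdges H w) : w ∉ e := ((mem_offEdges H w e).mp he).2

/-- An off-edge is an edge. -/
theorem mem_edgeFinset_of_mem_offEdges (H : SimpleGraph V) [DecidableRel H.Adj] (w : V) {e : Sym2 V}
    (he : e ∈ offEdges H w) : e ∈ H.edgeFinset := ((mem_offEdges H w e).mp he).1

/-- **THE DEGREE OF `v ≠ w`:** `d(v) = [w ~ v] + offDeg w v`. -/
theorem deg_eq_boole_add_offDeg (H : SimpleGraph V) [DecidableRel H.Adj] (w v : V) (hvw : v ≠ w) :
    deg H v = (if H.Adj w v then 1 else 0) + offDeg H w v := by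
  rw [deg_eq_card_filter_mem]
  unfold offDeg offEdges
  have key : H.edgeFinset.filter (fun g => v ∈ g) =
      (if H.Adj w v then {s(v, w)} else ∅) ∪ (H.edgeFinset.filter (fun e => w ∉ e)).filter (fun e => v ∈ e) := by
    ext g
    simp only [mem_filter, mem_union]
    constructor
    · rintro ⟨hg, hvg⟩
      by_cases hwg : w ∈ g
      · left
        have hg' : g = s(v, w) := (Sym2.mem_and_mem_iff hvw).mp ⟨hvg, hwg⟩
        have hadj : H.Adj v w := by
          rw [hg'] at hg
          exact (SimpleGraph.mem_edgeSet H).mp (SimpleGraph.mem_edgeFinset.mp hg)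
        rw [if_pos hadj.symm, mem_singleton]
        exact hg'
      · right
        exact ⟨⟨hg, hwg⟩, hvg⟩
    · rintro (h | ⟨⟨hg, -⟩, hvg⟩)
      · split_ifs at h with hadj
        · rw [mem_singleton] at h
          subst h
          exact ⟨SimpleGraph.mem_edgeFinset.mpr ((SimpleGraph.mem_edgeSet H).mpr hadj.symm),
            Sym2.mem_mk_left v w⟩
        · exact absurd h (Finset.notMem_empty _)
      · exact ⟨hg, hvg⟩
  have hd : Disjoint (if H.Adj w v then ({s(v, w)} : Finset (Sym2 V)) else ∅)
      ((H.edgeFinset.filter (fun e => w ∉ e)).filter (fun e => v ∈ e)) := by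
    rw [disjoint_left]
    intro g hg hg'
    split_ifs at hg with hadj
    · rw [mem_singleton] at hg
      subst hg
      exact (mem_filter.mp (mem_filter.mp hg').1).2 (Sym2.mem_mk_right v w)
    · exact absurd hg (Finset.notMem_empty _)
  rw [key, card_union_of_disjoint hd, apply_ite Finset.card, card_singleton, card_empty]

/-- `Σ_{v ≠ w} offDeg w v = 2 |F|` (each off-edge has two ends, both `≠ w`). -/
theorem sum_erase_offDeg (H : SimpleGraph V) [DecidableRel H.Adj] (w : V) :
    ∑ v ∈ (univ : Finset V).erase w, offDeg H w v = 2 * (offEdges H w).card := by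
  unfold offDeg
  simp_rw [card_filter]
  rw [sum_comm]
  rw [sum_const_nat (m := 2) (fun e he =>
    sum_erase_boole_mem H w e (mem_edgeFinset_of_mem_offEdges H w he) (notMem_of_mem_offEdges H w he)), mul_comm]

/-- `Σ_{v ≠ w} [w ~ v] · offDeg w v = attach`. -/
theorem sum_erase_boole_mul_offDeg (H : SimpleGraph V) [DecidableRel H.Adj] (w : V) :
    ∑ v ∈ (univ : Finset V).erase w, (if H.Adj w v then 1 else 0) * offDeg H w v = attach H w := by
  unfold attach
  rw [sum_filter, ← sum_erase (univ : Finset V) (a := w) (by simp only [SimpleGraph.irrefl, if_false])]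
  apply sum_congr rfl
  intro v _
  split_ifs <;> simp

/-- The ordered pairs of distinct off-edges sharing a vertex are the disjoint union over `v ≠ w` of the ordered
pairs of distinct off-edges through `v`. -/
theorem offAdjPairs_eq_biUnion (H : SimpleGraph V) [DecidableRel H.Adj] (w : V) :
    (offEdges H w).offDiag.filter (fun p : Sym2 V × Sym2 V => ∃ v, v ∈ p.1 ∧ v ∈ p.2) =
      ((univ : Finset V).erase w).biUnion (fun v => ((offEdges H w).filter (fun e => v ∈ e)).offDiag) := by
  ext ⟨e, f⟩
  simp only [mem_filter, mem_offDiag, mem_biUnion, mem_erase, mem_univ, and_true]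
  constructor
  · rintro ⟨⟨he, hf, hne⟩, v, hve, hvf⟩
    refine ⟨v, ?_, ⟨he, hve⟩, ⟨hf, hvf⟩, hne⟩
    intro hvw
    subst hvw
    exact notMem_of_mem_offEdges H v he hve
  · rintro ⟨v, -, ⟨he, hve⟩, ⟨hf, hvf⟩, hne⟩
    exact ⟨⟨he, hf, hne⟩, v, hve, hvf⟩

/-- `Σ_{v ≠ w} offDeg w v (offDeg w v − 1) = offAdjPairs`. -/
theorem sum_erase_offDeg_mul_pred (H : SimpleGraph V) [DecidableRel H.Adj] (w : V) :
    ∑ v ∈ (univ : Finset V).erase w, offDeg H w v * (offDeg H w v - 1) = offAdjPairs H w := by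
  unfold offAdjPairs
  rw [offAdjPairs_eq_biUnion, card_biUnion]
  · apply sum_congr rfl
    intro v _
    rw [offDiag_card]
    unfold offDeg
    rcases Nat.eq_zero_or_pos ((offEdges H w).filter (fun e => v ∈ e)).card with h0 | hpos
    · rw [h0]
    · have : ((offEdges H w).filter (fun e => v ∈ e)).card * (((offEdges H w).filter (fun e => v ∈ e)).card - 1) =
          ((offEdges H w).filter (fun e => v ∈ e)).card * ((offEdges H w).filter (fun e => v ∈ e)).card -
            ((offEdges H w).filter (fun e => v ∈ e)).card := by
        obtain ⟨c, hc⟩ : ∃ c, ((offEdges H w).filter (fun e => v ∈ e)).card = c + 1 :=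
          ⟨((offEdges H w).filter (fun e => v ∈ e)).card - 1, by omega⟩
        rw [hc]
        have := Nat.le_mul_self (c + 1)
        rw [Nat.add_sub_cancel]
        have e1 : (c + 1) * (c + 1) = (c + 1) * c + (c + 1) := by ring
        rw [e1, Nat.add_sub_cancel]
      exact this
  · intro v _ v' _ hvv'
    show Disjoint ((offEdges H w).filter (fun e => v ∈ e)).offDiag ((offEdges H w).filter (fun e => v' ∈ e)).offDiag
    rw [disjoint_left]
    rintro ⟨e, f⟩ hv hv'
    simp only [mem_offDiag, mem_filter] at hv hv'
    obtain ⟨⟨-, hve⟩, ⟨-, hvf⟩, hne⟩ := hv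
    obtain ⟨⟨-, hv'e⟩, ⟨-, hv'f⟩, -⟩ := hv'
    exact hne (eq_of_mem_mem_of_ne hvv' hve hv'e hvf hv'f)

/-- **THE VERTEX DECOMPOSITION:** for every graph and every vertex `w`,
`Σ_v d(v)² = d(w)² + d(w) + 2 |F| + 2 attach + offAdjPairs`. -/
theorem sum_deg_sq_vertex_decomposition (H : SimpleGraph V) [DecidableRel H.Adj] (w : V) :
    ∑ v, deg H v * deg H v =
      deg H w * deg H w + deg H w + 2 * (offEdges H w).card + 2 * attach H w + offAdjPairs H w := by
  have e1 := add_sum_erase (univ : Finset V) (fun v => deg H v * deg H v) (mem_univ w)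
  rw [← e1]
  have hsum : ∑ v ∈ (univ : Finset V).erase w, deg H v * deg H v =
      ∑ v ∈ (univ : Finset V).erase w,
        ((if H.Adj w v then 1 else 0) + 2 * ((if H.Adj w v then 1 else 0) * offDeg H w v) + offDeg H w v +
          offDeg H w v * (offDeg H w v - 1)) := by
    apply sum_congr rfl
    intro v hv
    rw [deg_eq_boole_add_offDeg H w v (mem_erase.mp hv).1]
    rcases Nat.eq_zero_or_pos (offDeg H w v) with h0 | hpos
    · rw [h0]
      split_ifs <;> ring
    · obtain ⟨c, hc⟩ : ∃ c, offDeg H w v = c + 1 := ⟨offDeg H w v - 1, by omega⟩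
      rw [hc, Nat.add_sub_cancel]
      split_ifs <;> ring
  rw [hsum, sum_add_distrib, sum_add_distrib, sum_add_distrib, ← mul_sum, sum_erase_boole_adj,
    sum_erase_boole_mul_offDeg, sum_erase_offDeg, sum_erase_offDeg_mul_pred]
  ring

/-- `attach` double-counted: `attach = Σ_{e ∈ F} |N(w) ∩ e|`. -/
theorem attach_eq_sum_card (H : SimpleGraph V) [DecidableRel H.Adj] (w : V) :
    attach H w = ∑ e ∈ offEdges H w, (univ.filter (fun v => H.Adj w v ∧ v ∈ e)).card := by
  unfold attach offDeg
  simp_rw [card_filter]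
  rw [sum_comm]
  apply sum_congr rfl
  intro e _
  rw [sum_filter]
  apply sum_congr rfl
  intro v _
  by_cases h1 : H.Adj w v <;> by_cases h2 : v ∈ e <;> simp [h1, h2]

/-- **`attach ≤ |F|` in a triangle-free graph:** each off-edge meets `N(w)` at most once. -/
theorem attach_le (H : SimpleGraph V) [DecidableRel H.Adj] (hfree : H.CliqueFree 3) (w : V) :
    attach H w ≤ (offEdges H w).card := by
  rw [attach_eq_sum_card, card_eq_sum_ones]
  apply sum_le_sum
  intro e he
  exact card_adj_mem_le_one H hfree w e (mem_edgeFinset_of_mem_offEdges H w he)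

/-- `offAdjPairs + |F| ≤ |F|²` (the pairs sharing a vertex are among the `|F| (|F| − 1)` ordered pairs). -/
theorem offAdjPairs_add_le (H : SimpleGraph V) [DecidableRel H.Adj] (w : V) :
    offAdjPairs H w + (offEdges H w).card ≤ (offEdges H w).card * (offEdges H w).card := by
  unfold offAdjPairs
  have h1 : ((offEdges H w).offDiag.filter (fun p : Sym2 V × Sym2 V => ∃ v, v ∈ p.1 ∧ v ∈ p.2)).card ≤
      (offEdges H w).offDiag.card := card_le_card (filter_subset _ _)
  rw [offDiag_card] at h1
  have := Nat.le_mul_self (offEdges H w).card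
  omega

/-- The arithmetic of the vertex bound: `S = d² + d + 2 t + 2 A + P`, `A ≤ t`, `P + t ≤ t²`, `1 ≤ d` ⇒
`S + 2 t (d − 1) ≤ (d + t)(d + t + 1)`, with equality iff `A = t` and `P + t = t²`. -/
theorem vertex_bound_arith (S d t A P : ℕ) (hd : 1 ≤ d) (hS : S = d * d + d + 2 * t + 2 * A + P) (hA : A ≤ t)
    (hP : P + t ≤ t * t) :
    S + 2 * (t * (d - 1)) ≤ (d + t) * (d + t + 1) ∧
      (S + 2 * (t * (d - 1)) = (d + t) * (d + t + 1) ↔ A = t ∧ P + t = t * t) := by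
  obtain ⟨d', rfl⟩ : ∃ d', d = d' + 1 := ⟨d - 1, by omega⟩
  have e2 : d' + 1 - 1 = d' := by omega
  rw [e2]
  subst hS
  refine ⟨by nlinarith, ⟨fun h => ⟨by nlinarith, by nlinarith⟩, fun ⟨h1, h2⟩ => by nlinarith⟩⟩

/-- **THE VERTEX BOUND WITH ITS EQUALITY CASE:** in a triangle-free graph with `s` edges and a non-isolated vertex
`w` with `t = s − d(w)` off-edges, `Σ_v d(v)² + 2 t (d(w) − 1) ≤ s (s + 1)`, with equality iff every off-edge meets
`N(w)` (`attach = t`) and every two off-edges share a vertex (`offAdjPairs + t = t²`). -/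
theorem vertex_bound_eq_iff (H : SimpleGraph V) [DecidableRel H.Adj] (hfree : H.CliqueFree 3) (w : V)
    (hw : 1 ≤ deg H w) :
    ∑ v, deg H v * deg H v + 2 * ((offEdges H w).card * (deg H w - 1)) ≤
        H.edgeFinset.card * (H.edgeFinset.card + 1) ∧
      (∑ v, deg H v * deg H v + 2 * ((offEdges H w).card * (deg H w - 1)) =
          H.edgeFinset.card * (H.edgeFinset.card + 1) ↔
        attach H w = (offEdges H w).card ∧
          offAdjPairs H w + (offEdges H w).card = (offEdges H w).card * (offEdges H w).card) := by
  have hdec := sum_deg_sq_vertex_decomposition H w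
  have hcard := card_offEdges_add_deg H w
  have hA := attach_le H hfree w
  have hP := offAdjPairs_add_le H w
  have := vertex_bound_arith _ (deg H w) (offEdges H w).card (attach H w) (offAdjPairs H w) hw hdec hA hP
  rw [← hcard, Nat.add_comm (offEdges H w).card (deg H w)]
  exact this

end C047

end TriangleCap

end PercRepro
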